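import Mathlib
import Literature.Analysis.FluidPDE.SereginSverakPressureLocalTypeI
import Literature.Analysis.FluidPDE.SereginSverakPressure
import Literature.Analysis.FluidPDE.PineauVicolOneSliceGradient
import Literature.Analysis.FluidPDE.ClassicalNSIRescale
import Literature.Analysis.FluidPDE.ClassicalSolutionRegionRescale
import Literature.Analysis.FluidPDE.LocalTypeIProofs
import Literature.Analysis.FluidPDE.TaoLocalisationHolds
import Literature.Analysis.FluidPDE.AxisymQuotientRayAverage
import Summits.NavierStokesRegularity.NavierStokesRegularity.Theses.SwallowedContinuum
import HarnessLib

/-!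
# `SwallowedContinuum.RegularFibreTrivial` — fibres of the Lagrangian endpoint map over regular
  points are single labels (item stmt-NavierStokesRegularity-17617)

**Statement.** `ν > 0`, `T > 0`, `(u, p)` classical on `ℝ³ × [0, T)`, Leray–Hopf on `[0, T]` from
its rapidly decaying datum; `X` a flow map (`X 0 a = a`, `∂ₜX(t, a) = u(t, X(t, a))` on `[0, T)`)
converging uniformly to `Xs` as `t ↑ T`. If `u` stays bounded on `[T − r², T) × B(x, r)` then the
fibre `Xs⁻¹{x}` has at most one label.

PROOF.
1. *Interior gradient bound up to the final time* (`RegularFibre.exists_fderiv_bound_near_top`):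
   `‖∇u‖ ≤ K` on `(T − ρ², T) × B(x, ρ)`. The viscosity-normalising parabolic zoom `v = α u ∘ Φ`,
   `π = α² p ∘ Φ` (`Φ(s, y) = (T + βs, x + Ry)`, `α = R/ν`, `β = R²/ν`) is a classical solution of
   the unit-viscosity system on the open parabolic ball `Q(0, 1)` bounded by `αM`; its pressure
   differs from the zoom of Tao's gauge `q = p − (p(·,0) − p̃[u](0))` by a function of time, and the
   zoom of `q` lies in `L^{3/2}(Q(0, 1))` (`SereginSverak2002.lintegral_slab_gauged_pressure_lt_top`);
   so the tree's quantitative Serrin estimate `exists_forall_fderiv_le_of_bounded` (Serrin 1962;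
   Seregin–Šverák 2009 §2, in Pineau–Vicol's Lemma 9.1 rendering) bounds `∇v` on `Q(0, 1/2)`, and
   `∇v(s, y) = αR ∇u(Φ(s, y))` transports the bound back; `u(t, ·)` is then `K`-Lipschitz on the ball.
2. *Backward Grönwall* (`RegularFibre.dist_le_dist_mul_exp_backward`, Mathlib's
   `dist_le_of_trajectories_ODE_of_mem` for the time-reversed curves): two labels `a, b` of the fibre
   have trajectories inside `B(x, ρ/2)` for `t ∈ (t₁, T)`, hence
   `dist(X t₁ a, X t₁ b) ≤ e^{K(T − t₁)} dist(X s a, X s b) → 0` as `s ↑ T` — so `X t₁ a = X t₁ b`.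
3. *Backward uniqueness on `[0, t₁]`* (the same lemma with the global Lipschitz bound of
   `RegularFibre.slab_lipschitz`, as in `EndpointMap.slab_bounds`): `a = X 0 a = X 0 b = b`.

HONEST FRAMING: Lagrangian bookkeeping and local regularity for a HYPOTHETICAL solution up to a
possibly singular time; nothing here bears on the regularity problem itself.
-/

noncomputable section

set_option linter.dupNamespace false

namespace Summit.NavierStokesRegularity.NavierStokesRegularity.Theorems

open MeasureTheory Set Filter Topology Metric Function Literature.Analysis.FluidPDE
open scoped NNReal ENNReal

namespace RegularFibre

variable {ν T : ℝ} {u : ℝ → (EuclideanSpace ℝ (Fin 3)) → (EuclideanSpace ℝ (Fin 3))} {p : ℝ → (EuclideanSpace ℝ (Fin 3)) → ℝ}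

/-- **Interior gradient bound up to the final time.** For a classical solution on `[0, T)`
(viscosity `ν > 0`), Leray–Hopf on `[0, T]` from its datum, bounded by `M` on
`[T − r², T) × B(x₀, r)`, `r > 0`: there are `ρ > 0` and `K` with `‖∇u(t, y)‖ ≤ K` for
`T − ρ² < t < T`, `y ∈ B(x₀, ρ)` (parabolic zoom to unit viscosity + the tree's quantitative Serrin
estimate with the `L^{3/2}` gauge of the pressure). [cite: Serrin1962] [cite: PineauVicol2026, Lemma 9.1] -/
theorem exists_fderiv_bound_near_top (hν : 0 < ν) (hT : 0 < T)
    (hsol : IsClassicalNSSolutionOn (Ico 0 T) ν 0 u p) (hLH : IsLerayHopfOn T ν 0 (u 0) u)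
    (x₀ : EuclideanSpace ℝ (Fin 3)) {r M : ℝ} (hr : 0 < r)
    (hM : ∀ t ∈ Ico (T - r ^ 2) T, ∀ y ∈ ball x₀ r, ‖u t y‖ ≤ M) :
    ∃ ρ > 0, ∃ K : ℝ, ∀ t ∈ Ioo (T - ρ ^ 2) T, ∀ y ∈ ball x₀ ρ, ‖fderiv ℝ (u t) y‖ ≤ K := by
  -- nonnegative bound
  have hM0 : 0 ≤ M := (norm_nonneg _).trans
    (hM (T - r ^ 2 / 2) ⟨by nlinarith, by nlinarith⟩ x₀ (mem_ball_self hr))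
  -- scales: `R ≤ r`, `R²/ν ≤ r²`, `R²/ν ≤ T`
  set R : ℝ := min r (min (r * Real.sqrt ν) (Real.sqrt (ν * T))) with hR
  have hRpos : 0 < R := lt_min hr (lt_min (by positivity) (Real.sqrt_pos.2 (by positivity)))
  have hRr : R ≤ r := min_le_left _ _
  have hRν : R ≤ r * Real.sqrt ν := (min_le_right _ _).trans (min_le_left _ _)
  have hRT : R ≤ Real.sqrt (ν * T) := (min_le_right _ _).trans (min_le_right _ _)
  set α : ℝ := R / ν with hα
  set β : ℝ := R ^ 2 / ν with hβdef
  have hαpos : 0 < α := by positivity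
  have hβpos : 0 < β := by positivity
  have hβeq : β = α * R := by rw [hβdef, hα]; field_simp
  have hβT : β ≤ T := by
    have h2 : R ^ 2 ≤ ν * T := by
      have := pow_le_pow_left₀ hRpos.le hRT 2
      rwa [Real.sq_sqrt (by positivity)] at this
    rw [hβdef, div_le_iff₀ hν]; linarith
  have hβr : β ≤ r ^ 2 := by
    have h2 : R ^ 2 ≤ (r * Real.sqrt ν) ^ 2 := pow_le_pow_left₀ hRpos.le hRν 2
    rw [mul_pow, Real.sq_sqrt hν.le] at h2
    rw [hβdef, div_le_iff₀ hν]; linarith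
  -- the gauged pressure, the physical cylinder and the zoom
  set q : ℝ → (EuclideanSpace ℝ (Fin 3)) → ℝ := fun t x => p t x - (p t 0 - normalisedPressure (u t) 0) with hq
  set PO : TopologicalSpace.Opens (ℝ × (EuclideanSpace ℝ (Fin 3))) :=
    ⟨Ioo (T - β) T ×ˢ ball x₀ R, isOpen_Ioo.prod isOpen_ball⟩ with hPO
  have hPOslab : (PO : Set (ℝ × (EuclideanSpace ℝ (Fin 3)))) ⊆ Ioo 0 T ×ˢ (univ : Set (EuclideanSpace ℝ (Fin 3))) := by
    rintro ⟨t, x⟩ ⟨ht, -⟩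
    exact ⟨⟨by linarith [ht.1], ht.2⟩, mem_univ _⟩
  have hPOslab' : (PO : Set (ℝ × (EuclideanSpace ℝ (Fin 3)))) ⊆ Ico 0 T ×ˢ (univ : Set (EuclideanSpace ℝ (Fin 3))) :=
    hPOslab.trans (prod_mono Ioo_subset_Ico_self Subset.rfl)
  have hpre1set : stAffine β R T x₀ ⁻¹' (PO : Set (ℝ × (EuclideanSpace ℝ (Fin 3)))) =
      parabolicCylinder 1 (0 : ℝ × (EuclideanSpace ℝ (Fin 3))) := by
    have h := stAffine_preimage_cylinder_eq_parabolicCylinder hν hRpos T x₀ R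
    rw [div_self hRpos.ne'] at h
    exact h
  have hpre1 : stPreimage β R T x₀ PO = parabolicCylinderOpens 1 (0 : ℝ × (EuclideanSpace ℝ (Fin 3))) := by
    apply TopologicalSpace.Opens.ext
    rw [coe_stPreimage]
    exact hpre1set
  set Q : Set (ℝ × (EuclideanSpace ℝ (Fin 3))) := parabolicCylinder 1 (0 : ℝ × (EuclideanSpace ℝ (Fin 3))) with hQdef
  have hQo : IsOpen Q := isOpen_parabolicCylinder 1 0
  set v : ℝ → (EuclideanSpace ℝ (Fin 3)) → (EuclideanSpace ℝ (Fin 3)) := α • stPull β R T x₀ u with hvdef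
  set π : ℝ → (EuclideanSpace ℝ (Fin 3)) → ℝ := α ^ 2 • stPull β R T x₀ p with hπdef
  set πq : ℝ → (EuclideanSpace ℝ (Fin 3)) → ℝ := α ^ 2 • stPull β R T x₀ q with hπqdef
  -- the zoom is a classical solution of the unit-viscosity system on the open ball `Q(0,1)`
  have hreg : IsClassicalNSSolutionOnRegion Q 1 0 v π := by
    have h0 := (hsol.onRegion.mono_of_isOpen hPOslab' PO.isOpen).stRescale_of_isOpen PO.isOpen
      hαpos hRpos hβeq T x₀
    have hvisc : α * ν / R = 1 := by rw [hα, div_mul_cancel₀ R hν.ne', div_self hRpos.ne']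
    have hforce : ((α ^ 2 * R) • stPull β R T x₀ (0 : ℝ → (EuclideanSpace ℝ (Fin 3)) → (EuclideanSpace ℝ (Fin 3)))) = 0 := by
      funext s y; simp [stPull]
    rw [hvisc, hforce] at h0
    have hset : stAffine β R T x₀ ⁻¹' ((PO : TopologicalSpace.Opens (ℝ × (EuclideanSpace ℝ (Fin 3)))) : Set (ℝ × (EuclideanSpace ℝ (Fin 3)))) = Q := hpre1set
    rw [hset] at h0
    exact h0
  -- physical points of the zoom window
  have hphys : ∀ w ∈ Q, T + β * w.1 ∈ Ico (T - r ^ 2) T ∧ x₀ + R • w.2 ∈ ball x₀ r := by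
    intro w hw
    rw [hQdef, mem_parabolicCylinder] at hw
    simp only [Prod.fst_zero, one_pow, zero_sub, Prod.snd_zero, dist_zero_right] at hw
    obtain ⟨⟨hw1, hw2⟩, hw3⟩ := hw
    refine ⟨⟨?_, ?_⟩, ?_⟩
    · have : 0 ≤ β * (w.1 + 1) := mul_nonneg hβpos.le (by linarith)
      nlinarith
    · have : β * w.1 < 0 := mul_neg_of_pos_of_neg hβpos hw2
      linarith
    · rw [mem_ball, dist_eq_norm, add_sub_cancel_left, norm_smul, Real.norm_of_nonneg hRpos.le]
      calc R * ‖w.2‖ < R * 1 := mul_lt_mul_of_pos_left hw3 hRpos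
        _ ≤ r := by rw [mul_one]; exact hRr
  -- velocity bound on `Q(0,1)`
  have hvbd : ∀ w ∈ Q, ‖v w.1 w.2‖ ≤ α * M / 1 := by
    intro w hw
    obtain ⟨ht, hy⟩ := hphys w hw
    rw [div_one, hvdef, smul_stPull_apply, norm_smul, Real.norm_of_nonneg hαpos.le]
    exact mul_le_mul_of_nonneg_left (hM _ ht _ hy) hαpos.le
  -- suitability of the zoom with the gauged pressure (for the measurability of `πq`)
  have hsuit1 : IsSuitableWeakSolutionOn (parabolicCylinderOpens 1 (0 : ℝ × (EuclideanSpace ℝ (Fin 3)))) 1 0 v πq := by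
    have h0 := (SereginSverak2002.isSuitableWeakSolutionOn_gauge_of_classical hν hT hsol hLH PO
      hPOslab).stRescale hαpos hRpos hβeq T x₀
    have hvisc : α * ν / R = 1 := by rw [hα, div_mul_cancel₀ R hν.ne', div_self hRpos.ne']
    have hforce : ((α ^ 2 * R) • stPull β R T x₀ (0 : ℝ → (EuclideanSpace ℝ (Fin 3)) → (EuclideanSpace ℝ (Fin 3)))) = 0 := by
      funext s y; simp [stPull]
    rw [hvisc, hforce, hpre1] at h0
    exact h0
  -- `πq ∈ L^{3/2}(Q(0,1))`
  have hI : ∫⁻ z in Q, ‖πq z.1 z.2‖ₑ ^ (3 / 2 : ℝ) < ⊤ := by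
    rw [← hpre1set, hπqdef,
      setLIntegral_enorm_rpow_stRescale hβpos hRpos T x₀ (α ^ 2) q _ (by norm_num)]
    refine ENNReal.mul_lt_top (ENNReal.mul_lt_top
      (ENNReal.rpow_lt_top_of_nonneg (by norm_num) enorm_ne_top) ENNReal.ofReal_lt_top) ?_
    exact lt_of_le_of_lt (lintegral_mono_set hPOslab)
      (SereginSverak2002.lintegral_slab_gauged_pressure_lt_top hν hT hsol hLH)
  haveI : IsFiniteMeasure (volume.restrict Q) :=
    ⟨by rw [Measure.restrict_apply_univ]
        exact (SuitableCompactness.volume_parabolicCylinder_zero_ne_top 1).lt_top⟩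
  have hπqLp : MemLp (uncurry πq) (3 / 2) (volume.restrict Q) := by
    refine ⟨hsuit1.distributional.2.2.1.aestronglyMeasurable, ?_⟩
    have h32 : ((3 : ENNReal) / 2).toReal = 3 / 2 := by rw [ENNReal.toReal_div]; norm_num
    have h32top : (3 : ENNReal) / 2 ≠ ⊤ := (ENNReal.div_lt_top (by simp) (by simp)).ne
    rw [eLpNorm_eq_lintegral_rpow_enorm_toReal (by norm_num) h32top, h32]
    exact ENNReal.rpow_lt_top_of_nonneg (by positivity) hI.ne
  have h132 : (1 : ℝ≥0∞) ≤ 3 / 2 := by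
    rw [ENNReal.le_div_iff_mul_le (Or.inl (by norm_num)) (Or.inl (by norm_num))]
    norm_num
  have hπqint : IntegrableOn (uncurry πq) Q volume := hπqLp.integrable h132
  -- the gauge as a function of time, locally integrable on `Q(0,1)`
  set h : ℝ → ℝ := fun s => α ^ 2 * (p (T + β * s) 0 - normalisedPressure (u (T + β * s)) 0) with hhdef
  have hsub : ∀ w : ℝ × (EuclideanSpace ℝ (Fin 3)), π w.1 w.2 - h w.1 = πq w.1 w.2 := by
    intro w
    simp only [hπdef, hπqdef, hhdef, hq, smul_stPull_apply, smul_eq_mul]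
    ring
  have hhloc : LocallyIntegrableOn (fun w : ℝ × (EuclideanSpace ℝ (Fin 3)) => h w.1) Q volume := by
    have e : (fun w : ℝ × (EuclideanSpace ℝ (Fin 3)) => h w.1) = fun w => uncurry π w - uncurry πq w := by
      funext w
      have := hsub w
      simp only [uncurry] at this ⊢
      linarith
    rw [e]
    exact (hreg.smooth_pressure.continuousOn.locallyIntegrableOn hQo.measurableSet).sub
      hπqint.locallyIntegrableOn
  -- the quantitative Serrin estimate on `Q(0, 1)`
  set P : ℝ≥0 := (∫⁻ z in Q, ‖πq z.1 z.2‖ₑ ^ (3 / 2 : ℝ)).toNNReal with hPdef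
  obtain ⟨K, -, hK⟩ := exists_forall_fderiv_le_of_bounded (α * M) P
  have hPbd : ∫⁻ w in parabolicCylinder 1 (0 : ℝ × (EuclideanSpace ℝ (Fin 3))), ‖π w.1 w.2 - h w.1‖ₑ ^ (3 / 2 : ℝ) ≤
      ENNReal.ofReal ((1 : ℝ) ^ 2) * P := by
    rw [one_pow, ENNReal.ofReal_one, one_mul, hPdef, ENNReal.coe_toNNReal hI.ne]
    refine le_of_eq (lintegral_congr fun w => ?_)
    rw [hsub w]
  have hgrad := hK v π h 0 1 one_pos hreg hvbd hhloc hPbd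
  -- transport back: `∇u(t, y) = (αR)⁻¹ ∇v(s, y')` on `(T − ρ², T) × B(x₀, ρ)`, `ρ² ≤ β/4`, `ρ ≤ R/2`
  set ρ : ℝ := min (R / 2) (Real.sqrt β / 2) with hρdef
  have hρpos : 0 < ρ := lt_min (by positivity) (by positivity)
  have hρR : ρ ≤ R / 2 := min_le_left _ _
  have hρβ : ρ ^ 2 ≤ β / 4 := by
    have h1 : ρ ≤ Real.sqrt β / 2 := min_le_right _ _
    have h2 := pow_le_pow_left₀ hρpos.le h1 2
    rw [div_pow, Real.sq_sqrt hβpos.le] at h2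
    linarith
  refine ⟨ρ, hρpos, K / (α * R), fun t ht y hy => ?_⟩
  set s : ℝ := (t - T) / β with hs
  set y' : EuclideanSpace ℝ (Fin 3) := R⁻¹ • (y - x₀) with hy'
  have hts : T + β * s = t := by rw [hs]; field_simp; ring
  have hxy : x₀ + R • y' = y := by rw [hy', smul_smul, mul_inv_cancel₀ hRpos.ne', one_smul]; abel
  have ht0 : 0 ≤ t := by nlinarith [ht.1, hρβ, hβT, hT]
  have hw : ((s, y') : ℝ × (EuclideanSpace ℝ (Fin 3))) ∈ parabolicCylinder (1 / 2) (0 : ℝ × (EuclideanSpace ℝ (Fin 3))) := by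
    rw [mem_parabolicCylinder]
    simp only [Prod.fst_zero, zero_sub, Prod.snd_zero, dist_zero_right]
    refine ⟨⟨?_, ?_⟩, ?_⟩
    · rw [hs, lt_div_iff₀ hβpos]; nlinarith [ht.1, hρβ]
    · rw [hs, div_lt_iff₀ hβpos]; nlinarith [ht.2]
    · rw [hy', norm_smul, norm_inv, Real.norm_of_nonneg hRpos.le]
      rw [mem_ball, dist_eq_norm] at hy
      rw [inv_mul_lt_iff₀ hRpos]
      linarith
  have hb := hgrad (s, y') hw
  simp only [one_pow, div_one] at hb
  have hdiff : Differentiable ℝ (u (T + β * s)) := by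
    rw [hts]
    exact ((hsol.contDiff_velocity ⟨ht0, ht.2⟩).differentiable (by simp)).restrictScalars ℝ
  have e : fderiv ℝ (v s) y' = (α * R) • fderiv ℝ (u t) y := by
    rw [hvdef, fderiv_smul_stPull_slice hdiff y', hts, hxy]
  rw [e, norm_smul, Real.norm_of_nonneg (by positivity)] at hb
  rw [le_div_iff₀ (by positivity), mul_comm]
  exact hb



/-- **Global Lipschitz bound on a closed sub-slab** `[0, T'] ⊂ [0, T)` for a classical
Leray–Hopf solution from a rapidly decaying datum (Tao's class + Sobolev embedding; the argument
of `EndpointMap.slab_bounds`). [cite: Tao2011, Cor. 11.1 (arXiv Cor. 68)] -/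
theorem slab_lipschitz {ν T : ℝ} {u : ℝ → EuclideanSpace ℝ (Fin 3) → EuclideanSpace ℝ (Fin 3)}
    {p : ℝ → EuclideanSpace ℝ (Fin 3) → ℝ} (hν : 0 < ν)
    (hsol : IsClassicalNSSolutionOn (Ico 0 T) ν 0 u p) (hLH : IsLerayHopfOn T ν 0 (u 0) u)
    (hdec : HasRapidSpatialDecay (u 0)) {T' : ℝ} (hT' : T' ∈ Ioo 0 T) :
    ∃ B : ℝ≥0, ∀ t ∈ Icc 0 T', LipschitzWith B (u t) := by
  have hsolc : IsClassicalNSSolutionOn (Icc 0 T') ν 0 u p :=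
    hsol.mono (Icc_subset_Ico_right hT'.2) (uniqueDiffOn_Icc hT'.1)
  have hE : ∃ C : ℝ≥0, ∀ t ∈ Icc 0 T', ∫⁻ x, ‖u t x‖ₑ ^ 2 ≤ C :=
    ⟨(2 * VectorCalculus.kineticEnergy (u 0)).toNNReal, fun t ht =>
      hLH.lintegral_enorm_sq_le hν.le ⟨ht.1, ht.2.trans hT'.2.le⟩⟩
  have hB : HasBoundedSobolevNormsOn (Icc 0 T') u :=
    tao2011_hasBoundedSobolevNormsOn_holds hν hT'.1 hsolc hE hdec
  have hsm : ∀ t ∈ Icc 0 T', ContDiff ℝ (⊤ : ℕ∞) (u t) := fun t ht => hsolc.contDiff_velocity ht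
  obtain ⟨B₁, hB₁0, hB₁⟩ := hB.exists_forall_norm_iteratedFDeriv_le hsm 1
  refine ⟨⟨B₁, hB₁0⟩, fun t ht => ?_⟩
  refine lipschitzWith_of_nnnorm_fderiv_le
    (((hsm t ht).differentiable (by simp)).restrictScalars ℝ) fun x => ?_
  have h := hB₁ t ht x
  rw [norm_iteratedFDeriv_one] at h
  change ‖fderiv ℝ (u t) x‖ ≤ B₁
  exact h

/-- **Backward Grönwall for two integral curves.** If `f, g` solve `y' = v(t, y)` on `(s₀, s₁]`,
are continuous on `[s₀, s₁]`, stay in a set `S` on which `v(t, ·)` is `K`-Lipschitz, then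
`dist (f s₀) (g s₀) ≤ dist (f s₁) (g s₁) · e^{K (s₁ − s₀)}` (Mathlib's forward estimate
`dist_le_of_trajectories_ODE_of_mem` for the time-reversed curves, which solve `y' = −v(s₁ − τ, y)`).
[folklore] -/
theorem dist_le_dist_mul_exp_backward {E : Type*} [NormedAddCommGroup E] [NormedSpace ℝ E]
    {v : ℝ → E → E} {S : Set E} {K : ℝ≥0} {f g : ℝ → E} {s₀ s₁ : ℝ} (h01 : s₀ ≤ s₁)
    (hv : ∀ t ∈ Ioc s₀ s₁, LipschitzOnWith K (v t) S)
    (hf : ContinuousOn f (Icc s₀ s₁)) (hg : ContinuousOn g (Icc s₀ s₁))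
    (hf' : ∀ t ∈ Ioc s₀ s₁, HasDerivAt f (v t (f t)) t)
    (hg' : ∀ t ∈ Ioc s₀ s₁, HasDerivAt g (v t (g t)) t)
    (hfs : ∀ t ∈ Ioc s₀ s₁, f t ∈ S) (hgs : ∀ t ∈ Ioc s₀ s₁, g t ∈ S) :
    dist (f s₀) (g s₀) ≤ dist (f s₁) (g s₁) * Real.exp (K * (s₁ - s₀)) := by
  -- the reversed curves and field
  set F : ℝ → E := fun τ => f (s₁ - τ) with hF
  set G : ℝ → E := fun τ => g (s₁ - τ) with hG
  set w : ℝ → E → E := fun τ y => -(v (s₁ - τ) y) with hw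
  have hmem : ∀ τ ∈ Ico 0 (s₁ - s₀), s₁ - τ ∈ Ioc s₀ s₁ := fun τ hτ =>
    ⟨by linarith [hτ.2], by linarith [hτ.1]⟩
  have hmaps : MapsTo (fun τ : ℝ => s₁ - τ) (Icc 0 (s₁ - s₀)) (Icc s₀ s₁) := fun τ hτ =>
    ⟨by linarith [hτ.2], by linarith [hτ.1]⟩
  have hrev : Continuous fun τ : ℝ => s₁ - τ := by fun_prop
  have hwlip : ∀ τ ∈ Ico 0 (s₁ - s₀), LipschitzOnWith K (w τ) S := by
    intro τ hτ
    refine LipschitzOnWith.of_dist_le_mul fun y hy z hz => ?_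
    rw [hw, dist_neg_neg]
    exact (hv _ (hmem τ hτ)).dist_le_mul y hy z hz
  have hderiv : ∀ {k : ℝ → E}, (∀ t ∈ Ioc s₀ s₁, HasDerivAt k (v t (k t)) t) →
      ∀ τ ∈ Ico 0 (s₁ - s₀),
        HasDerivWithinAt (fun τ => k (s₁ - τ)) (w τ (k (s₁ - τ))) (Ici τ) τ := by
    intro k hk τ hτ
    have h1 := (hk _ (hmem τ hτ)).scomp τ ((hasDerivAt_id τ).const_sub s₁)
    simp only [neg_one_smul] at h1
    exact h1.hasDerivWithinAt
  have key := dist_le_of_trajectories_ODE_of_mem (v := w) (s := fun _ => S) (K := K)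
    (f := F) (g := G) (a := 0) (b := s₁ - s₀) (δ := dist (f s₁) (g s₁)) hwlip
    (hf.comp hrev.continuousOn hmaps) (hderiv hf') (fun τ hτ => hfs _ (hmem τ hτ))
    (hg.comp hrev.continuousOn hmaps) (hderiv hg') (fun τ hτ => hgs _ (hmem τ hτ))
    (by simp [hF, hG]) (s₁ - s₀) ⟨by linarith, le_rfl⟩
  simpa [hF, hG] using key

end RegularFibre

open RegularFibre in
/-- **Item stmt-NavierStokesRegularity-17617** (`SwallowedContinuum.RegularFibreTrivial`): over a
point near which the velocity stays bounded up to the final time, the fibre of the Lagrangian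
endpoint map has at most one label (local Lipschitz bound up to `T` + backward Grönwall + backward
uniqueness on a closed sub-slab). [cite: Serrin1962] [cite: Tao2011, Prop. 9.1 context] -/
theorem swallowedContinuum_regularFibreTrivial_proof :
    Summit.NavierStokesRegularity.NavierStokesRegularity.Theses.SwallowedContinuum.RegularFibreTrivial := by
  unfold Summit.NavierStokesRegularity.NavierStokesRegularity.Theses.SwallowedContinuum.RegularFibreTrivial
  intro ν T hν hT u p hsol hLH hdec X Xs hX0 hXder hunif x hreg
  obtain ⟨r, hr, M, hM⟩ := hreg
  -- (1) local Lipschitz bound up to `T`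
  obtain ⟨ρ, hρ, K₀, hK₀⟩ := exists_fderiv_bound_near_top hν hT hsol hLH x hr hM
  set K : ℝ≥0 := (max K₀ 0).toNNReal with hKdef
  have hKcoe : (K : ℝ) = max K₀ 0 := Real.coe_toNNReal _ (le_max_right _ _)
  have hlip : ∀ t ∈ Ioo (T - ρ ^ 2) T, 0 ≤ t → LipschitzOnWith K (u t) (ball x ρ) := by
    intro t ht ht0
    refine (convex_ball x ρ).lipschitzOnWith_of_nnnorm_fderiv_le (𝕜 := ℝ)
      (fun y _ => (((hsol.contDiff_velocity ⟨ht0, ht.2⟩).differentiable (by simp)).restrictScalars ℝ y))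
      fun y hy => ?_
    rw [← NNReal.coe_le_coe, coe_nnnorm, hKcoe]
    exact (hK₀ t ht y hy).trans (le_max_left _ _)
  -- trajectories: continuity on `[0, T)` and derivative at interior times
  have hXcont : ∀ c, ContinuousOn (fun s => X s c) (Ico 0 T) := fun c t ht =>
    (hXder c t ht).continuousWithinAt
  have hXat : ∀ c, ∀ t ∈ Ioo 0 T, HasDerivAt (fun s => X s c) (u t (X t c)) t := fun c t ht =>
    (hXder c t ⟨ht.1.le, ht.2⟩).hasDerivAt (Ico_mem_nhds ht.1 ht.2)
  -- the fibre
  intro a ha b hb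
  rw [mem_preimage, mem_singleton_iff] at ha hb
  have hta : Tendsto (fun t => X t a) (𝓝[<] T) (𝓝 x) := by
    have h := hunif.tendsto_at a; rwa [ha] at h
  have htb : Tendsto (fun t => X t b) (𝓝[<] T) (𝓝 x) := by
    have h := hunif.tendsto_at b; rwa [hb] at h
  -- a late time `t₁` after which both trajectories stay in `B(x, ρ/2)` and `u` is Lipschitz there
  have hev : ∀ᶠ t in 𝓝[<] T, X t a ∈ ball x (ρ / 2) ∧ X t b ∈ ball x (ρ / 2) ∧ T - ρ ^ 2 < t := by
    have e1 : ∀ᶠ t in 𝓝[<] T, X t a ∈ ball x (ρ / 2) := hta (ball_mem_nhds x (by positivity))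
    have e2 : ∀ᶠ t in 𝓝[<] T, X t b ∈ ball x (ρ / 2) := htb (ball_mem_nhds x (by positivity))
    have e3 : ∀ᶠ t in 𝓝[<] T, T - ρ ^ 2 < t :=
      mem_of_superset (Ioo_mem_nhdsLT (by nlinarith : T - ρ ^ 2 < T)) fun t ht => ht.1
    exact e1.and (e2.and e3)
  obtain ⟨l, hlT, hl⟩ := mem_nhdsLT_iff_exists_Ioo_subset.1 hev
  set t₁ : ℝ := (max l 0 + T) / 2 with ht₁def
  have ht₁T : t₁ < T := by
    have : max l 0 < T := max_lt hlT hT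
    rw [ht₁def]; linarith
  have ht₁l : l < t₁ := by
    have : l ≤ max l 0 := le_max_left _ _
    rw [ht₁def]; linarith
  have ht₁0 : 0 < t₁ := by
    have : 0 ≤ max l 0 := le_max_right _ _
    rw [ht₁def]; linarith
  have hgood : ∀ t ∈ Ico t₁ T, X t a ∈ ball x (ρ / 2) ∧ X t b ∈ ball x (ρ / 2) ∧ T - ρ ^ 2 < t :=
    fun t ht => hl ⟨ht₁l.trans_le ht.1, ht.2⟩
  -- (2) backward Grönwall on `[t₁, s]`, `s ↑ T`: `X t₁ a = X t₁ b`
  have hbound : ∀ s ∈ Ico t₁ T, dist (X t₁ a) (X t₁ b) ≤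
      dist (X s a) (X s b) * Real.exp (K * (T - t₁)) := by
    intro s hs
    have hIoc : ∀ t ∈ Ioc t₁ s, t ∈ Ico t₁ T ∧ t ∈ Ioo 0 T := fun t ht =>
      ⟨⟨ht.1.le, ht.2.trans_lt hs.2⟩, ⟨ht₁0.trans ht.1, ht.2.trans_lt hs.2⟩⟩
    have hsub : Icc t₁ s ⊆ Ico 0 T := fun t ht => ⟨ht₁0.le.trans ht.1, ht.2.trans_lt hs.2⟩
    have h1 := dist_le_dist_mul_exp_backward (S := ball x ρ) (K := K) hs.1
      (fun t ht => hlip t ⟨(hgood t (hIoc t ht).1).2.2, (hIoc t ht).2.2⟩ (hIoc t ht).2.1.le)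
      ((hXcont a).mono hsub) ((hXcont b).mono hsub)
      (fun t ht => hXat a t (hIoc t ht).2) (fun t ht => hXat b t (hIoc t ht).2)
      (fun t ht => ball_subset_ball (by linarith) (hgood t (hIoc t ht).1).1)
      (fun t ht => ball_subset_ball (by linarith) (hgood t (hIoc t ht).1).2.1)
    refine h1.trans (mul_le_mul_of_nonneg_left ?_ dist_nonneg)
    exact Real.exp_le_exp.2 (mul_le_mul_of_nonneg_left (by linarith [hs.2]) K.coe_nonneg)
  have hlim : Tendsto (fun s => dist (X s a) (X s b) * Real.exp (K * (T - t₁))) (𝓝[<] T)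
      (𝓝 (dist x x * Real.exp (K * (T - t₁)))) := (hta.dist htb).mul_const _
  rw [dist_self, zero_mul] at hlim
  have hev' : ∀ᶠ s in 𝓝[<] T, dist (X t₁ a) (X t₁ b) ≤ dist (X s a) (X s b) * Real.exp (K * (T - t₁)) :=
    mem_of_superset (Ico_mem_nhdsLT ht₁T) fun s hs => hbound s hs
  have heq₁ : X t₁ a = X t₁ b :=
    dist_le_zero.1 (ge_of_tendsto hlim hev')
  -- (3) backward uniqueness on `[0, t₁]`
  obtain ⟨B, hBlip⟩ := slab_lipschitz hν hsol hLH hdec (T' := t₁) ⟨ht₁0, ht₁T⟩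
  have hsub0 : Icc 0 t₁ ⊆ Ico 0 T := fun t ht => ⟨ht.1, ht.2.trans_lt ht₁T⟩
  have h0 := dist_le_dist_mul_exp_backward (S := univ) (K := B) ht₁0.le
    (fun t ht => (hBlip t ⟨ht.1.le, ht.2⟩).lipschitzOnWith)
    ((hXcont a).mono hsub0) ((hXcont b).mono hsub0)
    (fun t ht => hXat a t ⟨ht.1, ht.2.trans_lt ht₁T⟩) (fun t ht => hXat b t ⟨ht.1, ht.2.trans_lt ht₁T⟩)
    (fun _ _ => mem_univ _) (fun _ _ => mem_univ _)
  rw [heq₁, dist_self, zero_mul, hX0 a, hX0 b] at h0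
  exact dist_le_zero.1 h0

end Summit.NavierStokesRegularity.NavierStokesRegularity.Theorems

end
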